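import Mathlib.FieldTheory.Finite.Basic
import Mathlib.GroupTheory.Coset.Card
import Mathlib.Algebra.Group.Subgroup.Finite
import HarnessLib

/-!
# X11b at `p = 3` (team N8/O2), JET3-KUMMER (α), the formal-group half: additive Hilbert 90 for a
# finite field in cyclic form (`Σ_{j<n} x^{qʲ} = 0 ⇒ x = b^q − b` when `#k = qⁿ`)

HONEST FRAMING (cell `b2b-bsdres`, run/shared/lean/b2b/bsd-rank1-residual/, verbatim in every
file): the goal of the cell is to DELETE the COMBINATION-SHAPED residual classes of the
Birch–Swinnerton-Dyer formula for ALL analytic-rank `≤ 1` elliptic curves over `ℚ` — "full BSD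
formula for every rank `≤ 1` curve in class `C`" assembled STRICTLY from published theorems — so
that the rank-`≤ 1` remainder becomes exactly the CONSTRUCTION-SHAPED classes, which are TYPED
(missing-input `Prop`s), NOT attempted. This is not "finishing BSD". Team N8/O2 = `x11b3`, seat
`b2b-bsdres-x11b3-p4`, LEAD DEAL #6 row R6-9 / A6.2 (S15 (i), the formal-group stub `h1ker`),
part 7: input (ii) of the tree's successive approximation
`FormalGroupChart.exists_map_sub_eq_of_sum_eq_zero` ("graded additive Hilbert 90") is, on the
residue field, the statement proved here. THEOREMS ONLY: no definition, no named fact, no `sorry`.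

## What

* `exists_frob_sub_eq_of_sum_pow_eq_zero` — for a finite field `k` with `#k = qⁿ` and a ring
  endomorphism `σ` with `σ x = x^q` (the `q`-Frobenius; `q = #k₀`, `n = [k : k₀]`): every `x` with
  `Σ_{j<n} σʲ x = 0` (trace zero to `k₀`) is `σ b − b` — Hilbert's Theorem 90 in additive form for
  the cyclic extension `k/k₀` (Serre, *Local Fields* X §1, Prop. 1; Lang, *Algebra* VI Thm. 6.3).
  Proof by counting: `℘ = σ − 1` and `T = Σ_{j<n} σʲ` satisfy `T ∘ ℘ = 0` (`σⁿ = 1`),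
  `#ker ℘ ≤ q` (roots of `X^q − X`) so `#im ℘ ≥ q^{n−1}`, and `#ker T ≤ q^{n−1}` (roots of
  `Σ X^{qʲ}`, a nonzero polynomial of degree `q^{n−1}`), hence `im ℘ = ker T`.

References (locators only; no new fact): [cite: SerreLocalFields1979, X §1 Prop. 1 and V §2];
S. Lang, *Algebra*, VI Thm. 6.3 (additive Hilbert 90).

## Design

Self-contained finite-field algebra (Mathlib only); `noncomputable section`;
`open scoped Classical`. Axioms: `propext`, `Classical.choice`, `Quot.sound`.
-/

noncomputable section

open scoped Classical

namespace Summit.BirchSwinnertonDyer.Rank1Residual.X11b.Three.JetchevKummer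

open Polynomial

/-- Iterates of the `q`-Frobenius: `σʲ x = x^{qʲ}`. [folklore] -/
theorem iterate_frob_eq_pow {k : Type*} [CommSemiring k] (σ : k →+* k) {q : ℕ}
    (hσ : ∀ x, σ x = x ^ q) (j : ℕ) (x : k) : (⇑σ)^[j] x = x ^ q ^ j := by
  induction j with
  | zero => simp
  | succ j ih => rw [Function.iterate_succ_apply', ih, hσ, ← pow_mul, ← pow_succ]

/-- **Additive Hilbert 90 for a finite field, cyclic form.** Let `k` be a finite field with
`#k = qⁿ` and `σ : k →+* k` with `σ x = x^q`. Then every `x ∈ k` with `Σ_{j<n} σʲ x = 0` is of the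
form `σ b − b`. (Trace-zero elements of the cyclic extension `k/𝔽_q` are `b^q − b`.) Proof by
counting kernels and images of `℘ = σ − 1` and `T = Σ_{j<n} σʲ` against the roots of `X^q − X`
and `Σ_{j<n} X^{qʲ}` (Lang, *Algebra*, VI Thm. 6.3, additive form of Hilbert 90).
[cite: SerreLocalFields1979, X §1 Prop. 1 (Hilbert 90) and V §2] -/
theorem exists_frob_sub_eq_of_sum_pow_eq_zero {k : Type*} [Field k] [Finite k] (σ : k →+* k)
    {q n : ℕ} (hcard : Nat.card k = q ^ n) (hσ : ∀ x, σ x = x ^ q) (x : k)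
    (hx : ∑ j ∈ Finset.range n, (⇑σ)^[j] x = 0) : ∃ b : k, σ b - b = x := by
  haveI : Fintype k := Fintype.ofFinite k
  have hcardF : Fintype.card k = q ^ n := by rw [← Nat.card_eq_fintype_card, hcard]
  -- `q ≥ 2`, `n ≥ 1`
  have hkn : 1 < q ^ n := by rw [← hcardF]; exact Fintype.one_lt_card
  have hn : n ≠ 0 := by rintro rfl; simp at hkn
  have hq : 1 < q := by
    by_contra h
    exact absurd hkn (not_lt.mpr (pow_le_one₀ (Nat.zero_le _) (not_lt.mp h)))
  have hq0 : 0 < q := lt_trans zero_lt_one hq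
  have hpow_card : ∀ y : k, y ^ q ^ n = y := fun y ↦ by rw [← hcardF, FiniteField.pow_card]
  have hiter := iterate_frob_eq_pow σ hσ
  -- `℘ = σ − 1` and `T = Σ σʲ`
  set ℘ : k →+ k := σ.toAddMonoidHom - AddMonoidHom.id k with h℘
  have h℘_apply : ∀ b, ℘ b = σ b - b := fun b ↦ rfl
  set T : k →+ k := ∑ j ∈ Finset.range n, (σ ^ j).toAddMonoidHom with hT
  have hT_apply : ∀ y, T y = ∑ j ∈ Finset.range n, (⇑σ)^[j] y := fun y ↦ by
    rw [hT, AddMonoidHom.finsetSum_apply]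
    exact Finset.sum_congr rfl fun j _ ↦ by rw [RingHom.toAddMonoidHom_eq_coe,
      AddMonoidHom.coe_coe, RingHom.coe_pow]
  -- `T ∘ ℘ = 0`
  have hle : ℘.range ≤ T.ker := by
    rintro _ ⟨b, rfl⟩
    rw [AddMonoidHom.mem_ker, hT_apply, h℘_apply]
    have : ∀ j, (⇑σ)^[j] (σ b - b) = (⇑σ)^[j + 1] b - (⇑σ)^[j] b := fun j ↦ by
      rw [Function.iterate_succ_apply, ← RingHom.coe_pow, map_sub]
    simp_rw [this]
    rw [Finset.sum_range_sub (fun j ↦ (⇑σ)^[j] b), Function.iterate_zero_apply, hiter, hpow_card,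
      sub_self]
  -- `#ker ℘ ≤ q`
  have hker℘ : Nat.card ℘.ker ≤ q := by
    have hsub : (℘.ker : Set k) ⊆ ((X ^ q - X : k[X]).roots.toFinset : Set k) := by
      intro b hb
      rw [SetLike.mem_coe, AddMonoidHom.mem_ker, h℘_apply, hσ, sub_eq_zero] at hb
      rw [Finset.mem_coe, Multiset.mem_toFinset, mem_roots (FiniteField.X_pow_card_sub_X_ne_zero k hq),
        IsRoot.def, eval_sub, eval_pow, eval_X, hb, sub_self]
    calc Nat.card ℘.ker = Nat.card (℘.ker : Set k) := rfl
      _ ≤ Nat.card ((X ^ q - X : k[X]).roots.toFinset : Set k) :=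
          Nat.card_mono (Set.toFinite _) hsub
      _ = (X ^ q - X : k[X]).roots.toFinset.card := Nat.card_eq_finsetCard _
      _ ≤ Multiset.card (X ^ q - X : k[X]).roots := Multiset.toFinset_card_le _
      _ ≤ (X ^ q - X : k[X]).natDegree := card_roots' _
      _ = q := FiniteField.X_pow_card_sub_X_natDegree_eq k hq
  -- `#ker T ≤ q^{n-1}`
  have hkerT : Nat.card T.ker ≤ q ^ (n - 1) := by
    set P : k[X] := ∑ j ∈ Finset.range n, X ^ q ^ j with hP
    have hPeval : ∀ y, P.eval y = T y := fun y ↦ by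
      rw [hP, eval_finsetSum, hT_apply]
      exact Finset.sum_congr rfl fun j _ ↦ by rw [eval_pow, eval_X, hiter]
    have hPdeg : P.natDegree ≤ q ^ (n - 1) := by
      refine natDegree_sum_le_of_forall_le _ _ fun j hj ↦ ?_
      rw [natDegree_X_pow]
      exact Nat.pow_le_pow_right hq0 (Nat.le_sub_one_of_lt (Finset.mem_range.mp hj))
    have hPne : P ≠ 0 := by
      intro h0
      have hc : P.coeff (q ^ (n - 1)) = 1 := by
        rw [hP, finsetSum_coeff]
        simp only [coeff_X_pow]
        rw [Finset.sum_ite, Finset.sum_const_zero, add_zero, Finset.sum_const, nsmul_eq_mul, mul_one]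
        have : (Finset.range n).filter (fun j ↦ q ^ (n - 1) = q ^ j) = {n - 1} := by
          ext j
          simp only [Finset.mem_filter, Finset.mem_range, Finset.mem_singleton]
          constructor
          · rintro ⟨-, h⟩
            exact (Nat.pow_right_injective hq h).symm
          · rintro rfl
            exact ⟨Nat.sub_one_lt hn, rfl⟩
        rw [this, Finset.card_singleton, Nat.cast_one]
      rw [h0, coeff_zero] at hc
      exact zero_ne_one hc
    have hsub : (T.ker : Set k) ⊆ (P.roots.toFinset : Set k) := by
      intro y hy
      rw [SetLike.mem_coe, AddMonoidHom.mem_ker] at hy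
      rw [Finset.mem_coe, Multiset.mem_toFinset, mem_roots hPne, IsRoot.def, hPeval, hy]
    calc Nat.card T.ker = Nat.card (T.ker : Set k) := rfl
      _ ≤ Nat.card (P.roots.toFinset : Set k) := Nat.card_mono (Set.toFinite _) hsub
      _ = P.roots.toFinset.card := Nat.card_eq_finsetCard _
      _ ≤ Multiset.card P.roots := Multiset.toFinset_card_le _
      _ ≤ P.natDegree := card_roots' _
      _ ≤ q ^ (n - 1) := hPdeg
  -- `#im ℘ ≥ q^{n-1}`
  have hrange : q ^ (n - 1) ≤ Nat.card ℘.range := by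
    have hmul : Nat.card ℘.range * Nat.card ℘.ker = q ^ n := by
      rw [← hcard, AddSubgroup.card_eq_card_quotient_mul_card_addSubgroup ℘.ker,
        Nat.card_congr (QuotientAddGroup.quotientKerEquivRange ℘).toEquiv]
    have h1 : q ^ (n - 1) * q = q ^ n := by
      rw [← pow_succ, Nat.sub_add_cancel (Nat.one_le_iff_ne_zero.mpr hn)]
    by_contra hlt
    rw [not_le] at hlt
    have : Nat.card ℘.range * Nat.card ℘.ker < q ^ (n - 1) * q :=
      Nat.mul_lt_mul_of_lt_of_le hlt hker℘ hq0
    rw [hmul, h1] at this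
    exact lt_irrefl _ this
  -- conclude
  have heq : ℘.range = T.ker := AddSubgroup.eq_of_le_of_card_ge hle (hkerT.trans hrange)
  have hxT : x ∈ T.ker := by rw [AddMonoidHom.mem_ker, hT_apply]; exact hx
  rw [← heq] at hxT
  obtain ⟨b, hb⟩ := hxT
  exact ⟨b, hb⟩

end Summit.BirchSwinnertonDyer.Rank1Residual.X11b.Three.JetchevKummer

end
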